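import Mathlib
import HarnessLib
import Summits.AtomisticToContinuum.FouriersLaw.Theses.JunctionLocality
import Summits.AtomisticToContinuum.FouriersLaw.Theses.BoundaryEscapeDeficit
import Summits.AtomisticToContinuum.FouriersLaw.Theorems.PhononMeanFreePathBoundaryKubo
import Summits.AtomisticToContinuum.FouriersLaw.Theorems.PhononMeanFreePathBoundaryKuboResponseIdentity
import Summits.AtomisticToContinuum.FouriersLaw.Theorems.JunctionLocalitySuperadditiveResistanceStubPlainKuboLinkAux3
import Summits.AtomisticToContinuum.FouriersLaw.Theorems.JunctionLocalitySuperadditiveResistanceStubPlainForwardField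

/-!
# Stub `stub_plainKuboLink` (S0c) of line `floating-probe-bypass-laplacian` — PROVED
# (crux stmt-AtomisticToContinuum-11748, `JunctionLocality.SuperadditiveResistance`)

S0c of the κ-frame skeleton `Cruxes/SuperadditiveResistance/Lines/floating_probe_bypass_laplacian.lean` (v6) is the
finite-volume Kubo formula `D_L/(L−1) = γ(1 − (γ/T²)⟨g, p_0² − T⟩_{μ_T})` for every left forward field `g` of the plain
`L`-chain along the crux's unique weak-NESS family — the ONLY stub of that skeleton that sees the NESS family. Its landed
reduction `kuboLink_of_responseIdentity` (`…StubPlainKuboLinkAux3`) derives it from the route item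
`BoundaryEscapeDeficit.ResponseIdentity` (stmt-AtomisticToContinuum-12237), which is now a consequence of two LANDED
theorems of route `PhononMeanFreePath`: `boundaryKubo_proof` (crux `BoundaryKubo`, stmt-AtomisticToContinuum-11812) and the
equivalence `boundaryKubo_iff_responseIdentity` (zeroth-moment sum rule). This file records the composition:
`stub_plainKuboLink`, verbatim (same namespace and vocabulary as the skeleton; `plainForwardFields` is the landed
`…StubPlainForwardField` copy, `plainKubo` is copied verbatim from the skeleton's §1).

Standard axioms; the only definition is the skeleton's `plainKubo` (an object of the line, verbatim).
-/

noncomputable section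

open MeasureTheory Filter Topology
open scoped ContDiff
open Literature.MathematicalPhysics.KineticTheory.HeatConduction
open Summit.AtomisticToContinuum.FouriersLaw.Theorems.SuperadditiveResistance.DeviceLiouville (kin)

namespace Summit.AtomisticToContinuum.FouriersLaw.Cruxes.SuperadditiveResistance.FloatingProbeBypassLaplacian

/-- The plain chain's two-terminal KUBO CONDUCTANCE read off a left forward field:
`G = γ(1 − (γ/T²)⟨g, p_0² − T⟩_{μ_T})` (verbatim from §1 of the registered skeleton v6). -/
def plainKubo (ω₂ lam β γ T : ℝ) (L : ℕ) (g : PhaseSpace L → ℝ) : ℝ :=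
  γ * (1 - γ / T ^ 2 * ∫ x, g x * (kin L 0 x - T) ∂((pinnedChain ω₂ lam β γ).gibbsMeasure L T))

/-- **S0c — KUBO LINK (registered stub `stub_plainKuboLink` of skeleton v6, PROVED).** Under the crux's hypotheses
(weak-NESS uniqueness, a steady-state family `μ`, its response coefficients `D > 0` at `T`): for every `L ≥ 2` and every
left forward field `g` of the plain `L`-chain, `D_L/(L−1) = γ(1 − (γ/T²)⟨g, p_0² − T⟩_{μ_T})`. Proof: the landed
reduction `kuboLink_of_responseIdentity` fed with `ResponseIdentity`, itself the landed `boundaryKubo_proof` transported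
by the landed `boundaryKubo_iff_responseIdentity`. [cite: ReyBellet2003, Rem. 4.4]
[cite: KunduDharNarayan2009, arXiv:0809.4543 p. 3] -/
theorem stub_plainKuboLink :
    ∀ (ω₂ lam β γ : ℝ) (μ : (N : ℕ) → ℝ → ℝ → Measure (PhaseSpace N)) (T : ℝ) (D : ℕ → ℝ),
      0 < ω₂ → 0 < lam → 0 < β → 0 < γ → 0 < T →
      (∀ (N : ℕ) (T_L T_R : ℝ), 0 < T_L → 0 < T_R → ∀ ρ ρ' : Measure (PhaseSpace N),
        (pinnedChain ω₂ lam β γ).IsSteadyState N T_L T_R ρ →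
        (pinnedChain ω₂ lam β γ).IsSteadyState N T_L T_R ρ' → ρ = ρ') →
      (∀ (N : ℕ) (T_L T_R : ℝ), 0 < T_L → 0 < T_R →
        (pinnedChain ω₂ lam β γ).IsSteadyState N T_L T_R (μ N T_L T_R)) →
      (∀ N : ℕ, Tendsto (fun δ : ℝ =>
        (pinnedChain ω₂ lam β γ).totalCurrent (μ N (T + δ / 2) (T - δ / 2)) / δ) (𝓝[≠] 0) (𝓝 (D N))) →
      (∀ N : ℕ, 2 ≤ N → 0 < D N) →
      ∀ L : ℕ, 2 ≤ L → ∀ g ∈ plainForwardFields ω₂ lam β γ T L,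
        D L / ((L : ℝ) - 1) = plainKubo ω₂ lam β γ T L g := by
  intro ω₂ lam β γ μ T D hω hl hβ hγ hT hU hμ hD hpos L hL g hg
  exact kuboLink_of_responseIdentity
    (Summit.AtomisticToContinuum.FouriersLaw.Theorems.IncoherentBounded.boundaryKubo_iff_responseIdentity.mp
      Summit.AtomisticToContinuum.FouriersLaw.Theorems.PhononMeanFreePathBoundaryKubo.boundaryKubo_proof)
    ω₂ lam β γ μ T D hω hl hβ hγ hT hU hμ hD hpos L hL g hg.1 hg.2.1 hg.2.2.1 hg.2.2.2

end Summit.AtomisticToContinuum.FouriersLaw.Cruxes.SuperadditiveResistance.FloatingProbeBypassLaplacian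

end
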